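import Summits.QuantumFields.YangMills.Theorems.UnitScaleTiltProp7CoverHilbertPullback
import Summits.QuantumFields.YangMills.Theorems.UnitScaleTiltProp7ProjRPullbackIntertwine
import Summits.QuantumFields.YangMills.Theorems.UnitScaleTiltProp7QprimeCombL2Defs
import Summits.QuantumFields.YangMills.Theorems.UnitScaleTiltCoverDeckOrbitSum
import Literature.MathematicalPhysics.QuantumFieldTheory.Balaban1983to89.B9B8KnitLetterPeriodic
import HarnessLib

/-!
# Route `UnitScaleTilt`, crux K1 «MinimiserStabilityRegPr» (stmt-QuantumFields-19200), route-R E′ (N06) LANE II (★★OWNER RULING №23), brick (C5-a) «LIFT TO A COVER»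
# (★p1 g19 NAMER WORDS №1∕№3∕№5), FILE F3 of px12 g7's LOCATE `LOCATE-C5a-COVERLIFT-px12g7.md` §2:
# **THE COMB SITE AVERAGE `Q′_k(W)` AND PRINT'S GAUGE PROJECTOR `R(W) = projR Δ_W Q′_k(W)` UNDER THE `L^{jc}`-FOLD COVER** —
# `Q′(W∘π)(λ∘π)(y′) = Q′(W)λ(π y′)` (the ℤ³ pullbacks at the base points COINCIDE), `ker` lifts and descends, `Q′(W) ∘ π_* = 0` on `ker Q′(W∘π)` (deck-orbit sums +
# translation covariance ✓`QprimeIter_bgT_shiftCfg`), hence by FILE F1 ✓`Prop7ProjRPullbackIntertwine.projR_intertwine_of_push`: **`R(W∘π)(λ̃∘π) = (R(W)λ̃)∘π`** and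
# `‖R(W∘π) D*_{W∘π}(X̃∘π)‖² = (L^{jc})³·‖R(W) D*_W X̃‖²`

Cell `ym3-torus` (HUMAN RULING D-0037, YM ladder rung R3 — YM₃ on T³ is a rung, NOT d = 4, NOT infinite volume, NOT a mass gap, NOT Clay; YM gap NOT proved), width seat
`ym3-torus-px12` (gen 7).  THEOREMS ONLY (0 `def`, 0 `sorry`); `--supports stmt-QuantumFields-19200 --as helper`; count-neutral.  Bookkeeping over ✓`CoverSites`∕✓`CoverDeckOrbitSum`,
✓`Prop7QprimeCombL2` (`QprimeCombL2_apply`, `QprimeIter_pullS_eq_apply_tcls`), lit ✓`B9B8KnitLetterPeriodic.QprimeIter_bgT_shiftCfg`, FILES F1∕F2b; nothing of (V3)∕`hN06`∕the crux is claimed.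

THE POINT (LOCATE §0 (V2)(V4)).  `QprimeCombL2 W v y := QprimeIter (zdBlocking 3 L) (bgT L (pull (bgUnits W) x₀)) k (z ↦ v♭(transl x₀ z)) (tlift y)`, `x₀ = basePt F n K = embIter k 0`, `k = K − n`.
For the cover member `F.cover jc` and the lifted data `W ∘ projBond`, `v♭ ∘ proj`: `proj x₀′ = x₀` and `proj (transl x₀′ z) = transl x₀ z`, so the two ℤ³ configurations and the two ℤ³ site
functions ARE EQUAL; the evaluation points `tlift y′`, `tlift (proj y′)` are congruent mod `N_k` and `Q′` is `N_k`-periodic (✓`isPeriodic_QprimeIter_pullS`).  The push-forward statement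
needed by F1 — `Q′(W)(π_* g) = 0` whenever `Q′(W∘π) g = 0` — is the deck-orbit sum (✓`sum_deck_site_eq_push_proj`) of translates of `g♯` by `N₀ = Lᵏ N_k`-multiples, each read by
✓`QprimeIter_bgT_shiftCfg` as `Q′(W∘π) g` at a deck translate of the coarse site.

References: T. Bałaban, CMP 99 (1985) 389–434 [Balaban1985BackgroundPropagators] ((3.19)–(3.23) pp.393–394); CMP 96 (1984) 223–250 [Balaban1984PropagatorsII] ((2.15)–(2.19) pp.225–226);
CMP 109 (1987) 249–301 [Balaban1987RG1] ((0.1)–(0.2) pp.251–252); CMP 98 (1985) 17–51 [Balaban1985Averaging] ((43) p.24, (79)–(80) p.30).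
-/

noncomputable section

open scoped InnerProductSpace Matrix.Norms.L2Operator BigOperators

namespace Summit.QuantumFields.YangMills.Theorems.Prop7CoverCombLetters

open Literature.MathematicalPhysics.QuantumFieldTheory.Balaban1983to89
open Literature.MathematicalPhysics.QuantumFieldTheory.Balaban1983to89.T3ContinuumYM3Torus
open B7Prop1Explicit renaming Site → LSite
open B7Eq78Linearization (QprimeIter zdBlocking QprimeIter_add QprimeIter_smul)
open B8Eq119TwistedAxial (bgT)
open B10Eq27TorusAxialLog (transl pull transl_apply pull_apply)
open B12Ineq417Flat (shiftCfg shiftCfg_apply)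
open B15DeterminingSets (embIter)
open T4TermwiseTorus (IsPeriodic tcls tlift tcls_tlift tcls_eq_tcls_iff)
open T3SectALandauChart (bgUnits eta)
open B11Eq103H1Complex (SiteL2K projR)
open CoverSites CoverDeckOrbitSum
open Summit.QuantumFields.YangMills.Theorems.Prop7SectET3Transport (periodsT3)
open Summit.QuantumFields.YangMills.Theorems.Prop7SectET3HilbertLetters (W₂ toL2 toL2S DL2 DstarL2 covLapSite adjoint_DL2)
open Summit.QuantumFields.YangMills.Theorems.Prop7SPrint (basePt)
open Summit.QuantumFields.YangMills.Theorems.Prop7QprimeCombL2 (QprimeCombL2 RcombL2 QprimeCombL2_apply QprimeIter_pullS_eq_apply_tcls RcombL2_eq_projR sitesPerDir_zero_eq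
  isPeriodic_QprimeIter_pullS)
open Summit.QuantumFields.YangMills.Theorems.Prop7LandauCombDict (isPeriodic_pull isPeriodic_comp_transl)
open Summit.QuantumFields.YangMills.Theorems.Prop7ProjRPullbackIntertwine (projR_intertwine_of_push)
open Summit.QuantumFields.YangMills.Theorems.Prop7CoverHilbertPullback (covLapSite_cover norm_sq_toL2S_cover DstarL2_cover' inner_toL2S_cover)
open Summit.QuantumFields.YangMills.Theorems.Prop7SectET3RealCoordSums (inner_toL2S)

variable (F : T3Family) (jc n K : ℕ) (c₀ : ℝ)

/-! ## §1 The ℤ³ pullbacks at the base points coincide -/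

/-- `proj` commutes with the integer translations `transl`. [cite: Balaban1987RG1, (0.1) p.251] -/
theorem proj_transl {P : Params} {jc i : ℕ} (y : Site (cover P jc) i) (z : LSite P.d) : proj P jc i (transl y z) = transl (proj P jc i y) z := by
  funext ν
  rw [proj_apply, transl_apply, transl_apply, map_add, map_intCast, proj_apply]

/-- `proj` commutes with the iterated centre embedding `embIter` (in the standing range). [cite: Balaban1987RG1, (0.1) p.251] -/
theorem proj_embIter {P : Params} {jc : ℕ} : ∀ (k : ℕ), k ≤ P.m + P.K → ∀ y : Site (cover P jc) k, proj P jc 0 (embIter k y) = embIter k (proj P jc k y)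
  | 0, _, y => rfl
  | k + 1, hk, y => by
      show proj P jc 0 (embIter k (emb y)) = embIter k (emb (proj P jc (k + 1) y))
      rw [proj_embIter k (by omega) (emb y), proj_emb P jc k hk y]

/-- ★ **THE BASE POINT OF THE COVER PROJECTS TO THE BASE POINT**: `proj (basePt (F.cover jc) n K) = basePt F n K` (no half-block offset: both are their own `k`-centre `embIter k 0`).
[cite: Balaban1987RG1, (0.1) p.251] -/
theorem proj_basePt (hnK : n ≤ K) : proj (F.P K) jc 0 (basePt (F.cover jc) n K) = basePt F n K := by
  show proj (F.P K) jc 0 (embIter (K - n) (0 : Site (cover (F.P K) jc) (K - n))) = embIter (K - n) (0 : Site (F.P K) (K - n))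
  rw [proj_embIter (K - n) (by show K - n ≤ F.m + K; omega)]
  exact congrArg (embIter (K - n)) (proj_zero (F.P K) jc (K - n))

/-- ★ **THE PULLED-BACK BACKGROUND OF THE LIFT IS THE PULLED-BACK BACKGROUND** (as ℤ³ configurations). [cite: Balaban1985Averaging, (9) p.18; Balaban1987RG1, (0.1) p.251] -/
theorem pull_bgUnits_cover (hnK : n ≤ K) (W : GaugeField (F.P K) 0 (Matrix.specialUnitaryGroup (Fin 2) ℂ)) :
    pull (bgUnits (F.cover jc) K (W ∘ projBond (F.P K) jc 0)) (basePt (F.cover jc) n K) = pull (bgUnits F K W) (basePt F n K) := by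
  funext z μ
  rw [pull_apply, pull_apply]
  show bgUnits F K W (projBond (F.P K) jc 0 ⟨transl (basePt (F.cover jc) n K) z, μ⟩) = bgUnits F K W ⟨transl (basePt F n K) z, μ⟩
  rw [← proj_basePt F jc n K hnK, ← proj_transl]
  rfl

/-- ★ **THE PULLED-BACK SITE FUNCTION OF THE LIFT IS THE PULLED-BACK SITE FUNCTION.** [cite: Balaban1987RG1, (0.1) p.251] -/
theorem comp_transl_basePt_cover (hnK : n ≤ K) {β : Type*} (l : Site (F.P K) 0 → β) :
    (fun z => (l ∘ proj (F.P K) jc 0) (transl (basePt (F.cover jc) n K) z)) = fun z => l (transl (basePt F n K) z) := by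
  funext z
  rw [Function.comp_apply, proj_transl, proj_basePt F jc n K hnK]

/-- The torus class of the cover's representative is the projection: `tcls N_i (tlift y′) = proj y′`. [cite: Balaban1987RG1, (0.1) p.251] -/
theorem tcls_tlift_cover {P : Params} {jc i : ℕ} (y : Site (cover P jc) i) : tcls (P.sitesPerDir i) (tlift y) = proj P jc i y := by
  funext κ
  rw [T4TermwiseTorus.tcls_apply, proj_apply, ZMod.castHom_apply, ZMod.cast_eq_val]
  show (((y κ).val : ℤ) : ZMod (P.sitesPerDir i)) = ((y κ).val : ZMod (P.sitesPerDir i))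
  rw [Int.cast_natCast]

/-! ## §2 `Q′(W∘π)(λ̃∘π) = Q′(W)λ̃ ∘ π` and the kernel -/

variable [Fact (0 < c₀)]

omit [Fact (0 < c₀)] in
/-- ★★ **THE COMB SITE AVERAGE OF THE LIFT IS THE LIFT OF THE COMB SITE AVERAGE.** [cite: Balaban1985BackgroundPropagators, (3.19) p.393; Balaban1987RG1, (0.1) p.251] -/
theorem QprimeCombL2_cover (hnK : n ≤ K) (W : GaugeField (F.P K) 0 (Matrix.specialUnitaryGroup (Fin 2) ℂ)) (l : Site (F.P K) 0 → Matrix (Fin 2) (Fin 2) ℂ)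
    (y : Site ((F.cover jc).P K) (K - n)) :
    QprimeCombL2 (F.cover jc) n K c₀ (W ∘ projBond (F.P K) jc 0) (toL2S (F.cover jc) K c₀ (l ∘ proj (F.P K) jc 0)) y
      = QprimeCombL2 F n K c₀ W (toL2S F K c₀ l) (proj (F.P K) jc (K - n) y) := by
  rw [QprimeCombL2_apply]
  have h1 : (fun z => (toL2S (F.cover jc) K c₀).symm (toL2S (F.cover jc) K c₀ (l ∘ proj (F.P K) jc 0)) (transl (basePt (F.cover jc) n K) z))
      = fun z => (toL2S F K c₀).symm (toL2S F K c₀ l) (transl (basePt F n K) z) := by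
    rw [LinearEquiv.symm_apply_apply, LinearEquiv.symm_apply_apply]
    exact comp_transl_basePt_cover F jc n K hnK l
  rw [h1]
  have h2 : pull (bgUnits (F.cover jc) K (W ∘ projBond (F.P K) jc 0)) (basePt (F.cover jc) n K) = pull (bgUnits F K W) (basePt F n K) :=
    pull_bgUnits_cover F jc n K hnK W
  have h3 : zdBlocking ((F.cover jc).P K).d ((F.cover jc).P K).L = zdBlocking (F.P K).d (F.P K).L := rfl
  rw [h2, h3]
  have h4 := QprimeIter_pullS_eq_apply_tcls (F := F) (c₀ := c₀) hnK W (toL2S F K c₀ l) (tlift y)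
  have h5 : ((F.cover jc).P K).L = (F.P K).L := rfl
  try rw [h5]
  exact h4.trans (congrArg _ (tcls_tlift_cover (P := F.P K) (jc := jc) (i := K - n) y))

omit [Fact (0 < c₀)] in
/-- ★ **THE KERNELS CORRESPOND**: `Q′(W∘π)(λ̃∘π) = 0 ↔ Q′(W)λ̃ = 0`. [cite: Balaban1985BackgroundPropagators, (3.21) p.394] -/
theorem QprimeCombL2_cover_eq_zero_iff (hnK : n ≤ K) (W : GaugeField (F.P K) 0 (Matrix.specialUnitaryGroup (Fin 2) ℂ)) (l : Site (F.P K) 0 → Matrix (Fin 2) (Fin 2) ℂ) :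
    QprimeCombL2 (F.cover jc) n K c₀ (W ∘ projBond (F.P K) jc 0) (toL2S (F.cover jc) K c₀ (l ∘ proj (F.P K) jc 0)) = 0
      ↔ QprimeCombL2 F n K c₀ W (toL2S F K c₀ l) = 0 := by
  constructor
  · intro h
    funext y
    obtain ⟨y', hy'⟩ := proj_surjective (F.P K) jc (K - n) y
    have hy := congrFun h y'
    rw [QprimeCombL2_cover F jc n K c₀ hnK, hy'] at hy
    exact hy
  · intro h
    funext y'
    rw [QprimeCombL2_cover F jc n K c₀ hnK, h]
    rfl

/-! ## §3 The push-forward: `Q′(W)(π_* g) = 0` for `g ∈ ker Q′(W∘π)` -/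

/-- Linearity of `QprimeIter` over finite sums. [cite: Balaban1985BackgroundPropagators, (3.19) p.393] -/
theorem QprimeIter_finset_sum {ι' : Type*} (s : Finset ι') {D L : ℕ} (T : LSite D → Fin D → (Matrix (Fin 2) (Fin 2) ℂ)ˣ) (j : ℕ)
    (f : ι' → LSite D → Matrix (Fin 2) (Fin 2) ℂ) (y : LSite D) :
    QprimeIter (zdBlocking D L) (bgT L T) j (fun x => ∑ i ∈ s, f i x) y = ∑ i ∈ s, QprimeIter (zdBlocking D L) (bgT L T) j (f i) y := by
  classical
  induction s using Finset.induction_on with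
  | empty =>
      simp only [Finset.sum_empty]
      have h := QprimeIter_smul (G := zdBlocking D L) (T := bgT L T) (0 : ℂ) (fun _ : LSite D => (0 : Matrix (Fin 2) (Fin 2) ℂ)) j
      simp only [zero_smul] at h
      exact congrFun h y
  | insert a s ha ih =>
      simp only [Finset.sum_insert ha]
      have h := QprimeIter_add (G := zdBlocking D L) (T := bgT L T) (f a) (fun x => ∑ i ∈ s, f i x) j
      rw [congrFun h y, ih]

/-- The deck translate of the cover's base-point translate, in ℤ³ coordinates: `transl x₀′ z + c·N₀ = transl x₀′ (z + N₀•c)`. [cite: Balaban1987RG1, (0.1) p.251] -/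
theorem deck_transl_eq (x : Site (cover (F.P K) jc) 0) (z : LSite (F.P K).d) (c : Fin (F.P K).d → Fin ((F.P K).L ^ jc)) :
    (fun ν => (transl x z) ν + (((c ν : ℕ) * (F.P K).sitesPerDir 0 : ℕ) : ZMod ((cover (F.P K) jc).sitesPerDir 0)))
      = transl x (z + (((F.P K).sitesPerDir 0 : ℕ) : ℤ) • fun ν => ((c ν : ℕ) : ℤ)) := by
  funext ν
  simp only [transl_apply, Pi.add_apply, Pi.smul_apply, smul_eq_mul, Int.cast_add, Int.cast_mul, Int.cast_natCast, Nat.cast_mul]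
  ring

omit [Fact (0 < c₀)] in
/-- ★★ **THE PUSH-FORWARD OF `ker Q′(W∘π)` LIES IN `ker Q′(W)`**: if `Q′(W∘π) g̃ = 0` then `Q′(W)(π_* g) = 0`, `(π_* g)(x) = Σ_{x′ ↦ x} g(x′)` (deck-orbit sum of `N₀`-translates of `g♯`,
each read by translation covariance as `Q′(W∘π) g̃` at a deck translate of the coarse site). [cite: Balaban1985BackgroundPropagators, (3.19) p.393, (3.21) p.394; Balaban1985Averaging, (79)-(80) p.30] -/
theorem QprimeCombL2_push_eq_zero (hnK : n ≤ K) (W : GaugeField (F.P K) 0 (Matrix.specialUnitaryGroup (Fin 2) ℂ))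
    (g : Site ((F.cover jc).P K) 0 → Matrix (Fin 2) (Fin 2) ℂ)
    (hg : QprimeCombL2 (F.cover jc) n K c₀ (W ∘ projBond (F.P K) jc 0) (toL2S (F.cover jc) K c₀ g) = 0) :
    QprimeCombL2 F n K c₀ W (toL2S F K c₀ (push (F.P K) jc 0 g)) = 0 := by
  letI : CStarAlgebra (Matrix (Fin 2) (Fin 2) ℂ) := B10Eq29TubeLine.cstarAlgebraMatrix 2
  funext y
  rw [QprimeCombL2_apply, Pi.zero_apply]
  simp only [LinearEquiv.symm_apply_apply]
  -- the pulled-back push-forward is the deck-orbit sum of `N₀`-translates of `g♯ = g ∘ transl x₀′`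
  have hsum : (fun z => push (F.P K) jc 0 g (transl (basePt F n K) z))
      = fun z => ∑ c : Fin (F.P K).d → Fin ((F.P K).L ^ jc),
          shiftCfg ((((F.P K).sitesPerDir 0 : ℕ) : ℤ) • fun ν => ((c ν : ℕ) : ℤ)) (fun z' => g (transl (basePt (F.cover jc) n K) z')) z := by
    funext z
    rw [← proj_basePt F jc n K hnK, ← proj_transl, ← sum_deck_site_eq_push_proj (F.P K) jc (Nat.zero_le _) g (transl (basePt (F.cover jc) n K) z)]
    refine Finset.sum_congr rfl fun c _ => ?_
    rw [shiftCfg_apply, deck_transl_eq]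
    rfl
  rw [hsum, QprimeIter_finset_sum (Finset.univ : Finset (Fin (F.P K).d → Fin ((F.P K).L ^ jc)))
    (pull (bgUnits F K W) (basePt F n K)) (K - n)
    (fun c => shiftCfg ((((F.P K).sitesPerDir 0 : ℕ) : ℤ) • fun ν => ((c ν : ℕ) : ℤ)) (fun z' => g (transl (basePt (F.cover jc) n K) z'))) (tlift y)]
  refine Finset.sum_eq_zero fun c _ => ?_
  -- translation covariance: `N₀•c = Lᵏ•(N_k•c)` and the background pullback is `N₀`-periodic
  have hN : ((((F.P K).sitesPerDir 0 : ℕ) : ℤ) • fun ν => ((c ν : ℕ) : ℤ))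
      = (((F.P K).L : ℤ) ^ (K - n)) • ((((F.P K).sitesPerDir (K - n) : ℕ) : ℤ) • fun ν => ((c ν : ℕ) : ℤ)) := by
    rw [smul_smul, sitesPerDir_zero_eq F n K hnK]
    push_cast
    rfl
  have hper : shiftCfg ((((F.P K).L : ℤ) ^ (K - n)) • ((((F.P K).sitesPerDir (K - n) : ℕ) : ℤ) • fun ν => ((c ν : ℕ) : ℤ)))
      (pull (bgUnits F K W) (basePt F n K)) = pull (bgUnits F K W) (basePt F n K) := by
    rw [← hN]
    funext z
    rw [shiftCfg_apply]
    exact isPeriodic_pull (bgUnits F K W) (basePt F n K) z _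
  have hcov := B9B8KnitLetterPeriodic.QprimeIter_bgT_shiftCfg (F.P K).L (pull (bgUnits F K W) (basePt F n K)) (K - n)
    ((((F.P K).sitesPerDir (K - n) : ℕ) : ℤ) • fun ν => ((c ν : ℕ) : ℤ)) (fun z' => g (transl (basePt (F.cover jc) n K) z')) (tlift y)
  rw [hper] at hcov
  rw [hN, hcov]
  -- read the cover's `Q′` at the deck translate: the ℤ³ data of the cover ARE `pull (bgUnits F K W) (basePt F n K)` and `g♯`
  have hread := QprimeIter_pullS_eq_apply_tcls (F := F.cover jc) (c₀ := c₀) hnK (W ∘ projBond (F.P K) jc 0) (toL2S (F.cover jc) K c₀ g)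
    (tlift y + (((F.P K).sitesPerDir (K - n) : ℕ) : ℤ) • fun ν => ((c ν : ℕ) : ℤ))
  rw [pull_bgUnits_cover F jc n K hnK W] at hread
  simp only [LinearEquiv.symm_apply_apply] at hread
  have h3 : zdBlocking ((F.cover jc).P K).d ((F.cover jc).P K).L = zdBlocking (F.P K).d (F.P K).L := rfl
  have h5 : ((F.cover jc).P K).L = (F.P K).L := rfl
  rw [h3, h5] at hread
  exact hread.trans (by rw [hg]; rfl)

/-! ## §4 The pullback and push-forward as linear maps; `R(W∘π) ∘ π* = π* ∘ R(W)` -/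

/-- `Δ_W = D*_W D_W` is symmetric. [cite: Balaban1985BackgroundPropagators, (3.23) p.394] -/
theorem covLapSite_symm (W : GaugeField (F.P K) 0 (Matrix.specialUnitaryGroup (Fin 2) ℂ)) (u v : SiteL2K ℂ 3 (periodsT3 F K) c₀ W₂) :
    ⟪covLapSite F n K c₀ W u, v⟫_ℂ = ⟪u, covLapSite F n K c₀ W v⟫_ℂ := by
  rw [covLapSite, LinearMap.comp_apply, LinearMap.comp_apply, ← adjoint_DL2, LinearMap.adjoint_inner_left, LinearMap.adjoint_inner_right]

/-- ★ **`⟪λ̃∘π, g̃⟫ = ⟪λ̃, π_* g̃⟫`** — the fibre sum is the adjoint partner of the pullback (same weight `c₀` on both members). [cite: Balaban1984PropagatorsII, (2.15) p.225] -/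
theorem inner_pull_eq_inner_push (l : Site (F.P K) 0 → Matrix (Fin 2) (Fin 2) ℂ) (g : Site ((F.cover jc).P K) 0 → Matrix (Fin 2) (Fin 2) ℂ) :
    ⟪toL2S (F.cover jc) K c₀ (l ∘ proj (F.P K) jc 0), toL2S (F.cover jc) K c₀ g⟫_ℂ = ⟪toL2S F K c₀ l, toL2S F K c₀ (push (F.P K) jc 0 g)⟫_ℂ := by
  classical
  rw [inner_toL2S, inner_toL2S]
  congr 1
  have h : ∀ x : Site (F.P K) 0, (∑ xt ∈ Finset.univ.filter (fun xt : Site (cover (F.P K) jc) 0 => proj (F.P K) jc 0 xt = x),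
      Matrix.trace ((l (proj (F.P K) jc 0 xt)).conjTranspose * g xt)) = Matrix.trace ((l x).conjTranspose * push (F.P K) jc 0 g x) := by
    intro x
    rw [push_apply, Finset.mul_sum, Matrix.trace_sum]
    refine Finset.sum_congr rfl fun xt hxt => ?_
    rw [(Finset.mem_filter.mp hxt).2]
  exact (Finset.sum_fiberwise_of_maps_to (s := Finset.univ) (t := Finset.univ) (g := proj (F.P K) jc 0) (fun _ _ => Finset.mem_univ _)
    (fun xt : Site (cover (F.P K) jc) 0 => Matrix.trace ((l (proj (F.P K) jc 0 xt)).conjTranspose * g xt))).symm.trans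
    (Finset.sum_congr rfl fun x _ => h x)

/-- ★★★ **`R(W∘π)(λ̃∘π) = (R(W)λ̃)∘π` — PRINT'S GAUGE PROJECTOR (3.21) COMMUTES WITH THE PULLBACK ALONG THE COVER** (FILE F1 ✓`projR_intertwine_of_push` with `π := λ̃ ↦ λ̃∘π`,
`ρ := π_*`, `Δ := covLapSite W`, `Q′ := QprimeCombL2 W`; hypotheses = §2–§4). [cite: Balaban1985BackgroundPropagators, (3.20)-(3.23) p.394; Balaban1984PropagatorsII, (2.18)-(2.19) p.226] -/
theorem RcombL2_cover (hnK : n ≤ K) (W : GaugeField (F.P K) 0 (Matrix.specialUnitaryGroup (Fin 2) ℂ)) (l : Site (F.P K) 0 → Matrix (Fin 2) (Fin 2) ℂ) :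
    RcombL2 (F.cover jc) n K c₀ (W ∘ projBond (F.P K) jc 0) (toL2S (F.cover jc) K c₀ (l ∘ proj (F.P K) jc 0))
      = toL2S (F.cover jc) K c₀ (((toL2S F K c₀).symm (RcombL2 F n K c₀ W (toL2S F K c₀ l))) ∘ proj (F.P K) jc 0) := by
  classical
  -- the pullback and the push-forward as ℂ-linear maps between the two members' `L²` spaces of gauge parameters
  let πL : SiteL2K ℂ 3 (periodsT3 F K) c₀ W₂ →ₗ[ℂ] SiteL2K ℂ 3 (periodsT3 (F.cover jc) K) c₀ W₂ :=
    (toL2S (F.cover jc) K c₀).toLinearMap ∘ₗ LinearMap.funLeft ℂ (Matrix (Fin 2) (Fin 2) ℂ) (proj (F.P K) jc 0) ∘ₗ (toL2S F K c₀).symm.toLinearMap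
  let pushL : (Site ((F.cover jc).P K) 0 → Matrix (Fin 2) (Fin 2) ℂ) →ₗ[ℂ] (Site (F.P K) 0 → Matrix (Fin 2) (Fin 2) ℂ) :=
    { toFun := push (F.P K) jc 0
      map_add' := fun g g' => by funext x; simp only [push_apply, Pi.add_apply, Finset.sum_add_distrib]
      map_smul' := fun c g => by funext x; simp only [push_apply, Pi.smul_apply, Finset.smul_sum, RingHom.id_apply] }
  let ρL : SiteL2K ℂ 3 (periodsT3 (F.cover jc) K) c₀ W₂ →ₗ[ℂ] SiteL2K ℂ 3 (periodsT3 F K) c₀ W₂ :=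
    (toL2S F K c₀).toLinearMap ∘ₗ pushL ∘ₗ (toL2S (F.cover jc) K c₀).symm.toLinearMap
  have hπ : ∀ l' : Site (F.P K) 0 → Matrix (Fin 2) (Fin 2) ℂ, πL (toL2S F K c₀ l') = toL2S (F.cover jc) K c₀ (l' ∘ proj (F.P K) jc 0) := by
    intro l'
    simp only [πL, LinearMap.comp_apply, LinearEquiv.coe_toLinearMap, LinearEquiv.symm_apply_apply]
    rfl
  have hρ : ∀ g : Site ((F.cover jc).P K) 0 → Matrix (Fin 2) (Fin 2) ℂ, ρL (toL2S (F.cover jc) K c₀ g) = toL2S F K c₀ (push (F.P K) jc 0 g) := by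
    intro g
    simp only [ρL, LinearMap.comp_apply, LinearEquiv.coe_toLinearMap, LinearEquiv.symm_apply_apply]
    rfl
  -- (h₁) adjoint pair
  have h₁ : ∀ (f : SiteL2K ℂ 3 (periodsT3 F K) c₀ W₂) (g : SiteL2K ℂ 3 (periodsT3 (F.cover jc) K) c₀ W₂), ⟪πL f, g⟫_ℂ = ⟪f, ρL g⟫_ℂ := by
    intro f g
    obtain ⟨l', rfl⟩ := (toL2S F K c₀).surjective f
    obtain ⟨g', rfl⟩ := (toL2S (F.cover jc) K c₀).surjective g
    rw [hπ, hρ]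
    exact inner_pull_eq_inner_push F jc K c₀ l' g'
  -- (hΔ) the covariant site Laplacian intertwines with the pullback
  have hΔ : ∀ f, πL (covLapSite F n K c₀ W f) = covLapSite (F.cover jc) n K c₀ (W ∘ projBond (F.P K) jc 0) (πL f) := by
    intro f
    obtain ⟨l', rfl⟩ := (toL2S F K c₀).surjective f
    rw [hπ, covLapSite_cover]
    conv_lhs => rw [← (toL2S F K c₀).apply_symm_apply (covLapSite F n K c₀ W (toL2S F K c₀ l'))]
    rw [hπ]
  -- (hΔ′) … and with the push-forward (by adjointness and symmetry)
  have hΔ' : ∀ g, ρL (covLapSite (F.cover jc) n K c₀ (W ∘ projBond (F.P K) jc 0) g) = covLapSite F n K c₀ W (ρL g) := by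
    intro g
    refine ext_inner_left ℂ fun f => ?_
    rw [← h₁, ← covLapSite_symm, ← hΔ, h₁, covLapSite_symm]
  -- (hQ) the kernel lifts, (hQ′) the push-forward of the kernel descends
  have hQ : ∀ f, QprimeCombL2 F n K c₀ W f = 0 → QprimeCombL2 (F.cover jc) n K c₀ (W ∘ projBond (F.P K) jc 0) (πL f) = 0 := by
    intro f hf
    obtain ⟨l', rfl⟩ := (toL2S F K c₀).surjective f
    rw [hπ]
    exact (QprimeCombL2_cover_eq_zero_iff F jc n K c₀ hnK W l').2 hf
  have hQ' : ∀ g, QprimeCombL2 (F.cover jc) n K c₀ (W ∘ projBond (F.P K) jc 0) g = 0 → QprimeCombL2 F n K c₀ W (ρL g) = 0 := by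
    intro g hg
    obtain ⟨g', rfl⟩ := (toL2S (F.cover jc) K c₀).surjective g
    rw [hρ]
    exact QprimeCombL2_push_eq_zero F jc n K c₀ hnK W g' hg
  have key := projR_intertwine_of_push (covLapSite F n K c₀ W) (covLapSite (F.cover jc) n K c₀ (W ∘ projBond (F.P K) jc 0))
    (QprimeCombL2 F n K c₀ W) (QprimeCombL2 (F.cover jc) n K c₀ (W ∘ projBond (F.P K) jc 0)) πL ρL h₁ hΔ hΔ' hQ hQ' (toL2S F K c₀ l)
  rw [RcombL2_eq_projR, RcombL2_eq_projR, ← hπ, key, ← hπ ((toL2S F K c₀).symm _), LinearEquiv.apply_symm_apply]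

/-- ★★★ **THE PROJECTED-DIVERGENCE SLOT SCALES BY THE DEGREE**: `‖R(W∘π) D*_{W∘π}(X̃∘π)‖² = (L^{jc})³·‖R(W) D*_W X̃‖²`. [cite: Balaban1985BackgroundPropagators, (3.21) p.394; Balaban1987RG1, (0.2) p.252] -/
theorem norm_sq_RcombL2_DstarL2_cover (hnK : n ≤ K) (W : GaugeField (F.P K) 0 (Matrix.specialUnitaryGroup (Fin 2) ℂ)) (X : PBond (F.P K) 0 → Matrix (Fin 2) (Fin 2) ℂ) :
    ‖RcombL2 (F.cover jc) n K c₀ (W ∘ projBond (F.P K) jc 0)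
        (DstarL2 (F.cover jc) n K c₀ (W ∘ projBond (F.P K) jc 0) (toL2 (F.cover jc) K c₀ (X ∘ projBond (F.P K) jc 0)))‖ ^ 2
      = ((F.L : ℝ) ^ jc) ^ 3 * ‖RcombL2 F n K c₀ W (DstarL2 F n K c₀ W (toL2 F K c₀ X))‖ ^ 2 := by
  rw [DstarL2_cover', RcombL2_cover F jc n K c₀ hnK, norm_sq_toL2S_cover, LinearEquiv.apply_symm_apply, LinearEquiv.apply_symm_apply]

end Summit.QuantumFields.YangMills.Theorems.Prop7CoverCombLetters

end
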